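import Summits.QuantumFields.YangMills.Theses.ContractibleFibre

/-!
# Birth skeleton (BC3) for crux `FibreContinuity` (stmt-QuantumFields-16242) — `Lines/birth.lean`

Registrar: `planner-skel-stmt-QuantumFields-16242-0` (skeleton-register one-shot; route
`route-QuantumFields-ContractibleFibre`, re-audit bin REPAIRABLE), 2026-08-17. Line card: `Lines/birth.md`.

Crux (route file `Theses/ContractibleFibre.lean`, decl
`Summit.QuantumFields.YangMills.Theses.ContractibleFibre.FibreContinuity`, rank 2, "continuity in the
fibre width"): for every compact simple `G` and faithful unitary `r`, IF the fixed-width anchor holds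
(for every width `M` there are `β₀(M)` and a `β`-uniform rate `m₀(M) > 0` clustering the free tube
`(ℤ/L)²×{0..M}²` in time for `β ≥ β₀(M)`), THEN there is ONE threshold `β₁` such that for every
`β ≥ β₁` ONE rate `m(β) > 0` and, per slab width `w`, ONE constant `C(β,w)` — both uniform in the fibre
width `M` — cluster the free tubes of EVERY width (volume floor `L_min(β,M,w)` free).

## The cut: along the FIBRE WIDTH at fixed `β` (thin widths / wide widths)

At fixed `β` the crux asks for uniformity of the time-clustering rate over ALL widths `M`. The two
obstructions live at opposite ends of the width axis and are separated here:

* `stub_widthwiseGap` (W — A GAP ON EVERY TUBE AT A WIDTH-UNIFORM THRESHOLD; the finite-width half).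
  Given the anchor, there is ONE `β₁` (not depending on `M`) such that for every `β ≥ β₁` and every
  width `M` the free tube of width `M` clusters in time at SOME rate `m(β,M) > 0` with SOME constants
  `C(β,M,w)`. The anchor supplies this only for the widths with `β₀(M) ≤ β` (thin tubes relative to
  the coupling); the content of W is the remaining widths at that `β` — a mass gap, with no uniformity
  asked, for each fixed-width tube (a two-dimensional lattice system with `(M+1)²` layers) at every
  large `β`. Group-blind in kind (expected true for `U(1)` too: the Kaluza–Klein photon tower on a
  tube of fixed width is massive). Why it might fail / size: for widths `M ≳ ξ(β)` the fixed-width tube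
  is a 2-d asymptotically-free-like system at intermediate effective coupling, where neither the
  strong- nor the weak-coupling expansion converges — "some gap at every coupling" is open already for
  the 2-d `O(3)` σ-model (`Literature…ONSigmaModelMassGapConjecture`). XL/open.
* `stub_crossoverWidth` (X — ONE RATE BEYOND A CROSSOVER WIDTH; the infrared core, the hardest piece).
  Given the anchor, there is `β₁` such that for every `β ≥ β₁` there are a crossover width `M₀(β)`, ONE
  rate `m(β) > 0` and per `w` ONE constant such that all free tubes of width `M ≥ M₀(β)` cluster at
  rate `m(β)` with that constant. This is where asymptotic freedom must enter (FALSE for `U(1)`: free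
  photon, gap `≍ π/M → 0`); in the quiver dictionary it is dimensional transmutation of the 2-d
  adjoint quiver at flavour-'t Hooft coupling `2/β` — the bulk weak-coupling gap seen from two
  dimensions, with the extra handle that only widths beyond a `β`-dependent crossover are asked and
  the thin-width data (the anchor, W) are available as input. Open-problem sized.
* `FibreContinuity_of : W-statement → X-statement → FibreContinuity` — a REAL proof (no `sorry`):
  `β₁ := max β₁ᵂ β₁ˣ`; at `β ≥ β₁` take `M₀(β)` from X; below `M₀(β)` there are finitely many widths,
  each gapped by W, and the monotonicity of the clustering bound in (rate, constant)
  (`TubeClusters.mono`: `|…| ≤ C e^(−mn) ⇒ |…| ≤ C' e^(−m'n)` for `m' ≤ m`, `|C| ≤ C'`) lets one take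
  the minimum rate and the maximum `|constant|` over `M < M₀(β)` (induction on `M₀`,
  `range_uniform`) and then join the tail (`all_widths`). The route's inline `let Tube := …` vocabulary
  is named here `TubeClusters G r M β m C w Lmin` with the SAME body (verbatim), so the crux's
  hypothesis and conclusion are definitionally `AnchorAt G r` and `UniformWidthGap G r` at the Borel
  σ-algebra; `FibreContinuity_of` concludes the route decl BY NAME.

Neither stub is the crux or the summit in disguise: W has the quantifiers `∀ M ∃ m` (no uniformity in
the width — strictly weaker than the crux's conclusion, and true in kind for the abelian foil where
the crux is false); X omits every width below a `β`-dependent crossover (strictly weaker: the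
width-uniform threshold for thin tubes is exactly W); neither mentions OS data, schemes, tori
`(2S+1)⁴` or `YangMills`. Both are consequences of the crux (pieces of its conclusion) and BOTH are
load-bearing in `FibreContinuity_of`. BC3 probes (registrar folder `bc/`, importing the route file,
`maxHeartbeats 400000`): `W → FibreContinuity`, `W → YangMills`, `X → FibreContinuity`,
`X → YangMills` by `first | exact? | simpa | aesop` (and per tactic) must FAIL — raw outputs in
`Lines/birth.md`.

## Disproof used

None exists: `ledger crux ls stmt-QuantumFields-16242` showed no workfiles before this one (no
`Disproof.lean`, no `Theorems/FibreContinuity/Negative/`, no registered line, no crux idea;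
2026-08-17). The summit's negatives index has no statement about free tubes / slabs / width
uniformity; no stub is an instance of a refuted statement. The abelian barrier
(`Literature.Barriers.QuantumFields.AbelianDeconfinementD4`) is honoured by the cut: it bites X only
(W is claimed in kind for every compact `G`), so a proof of X must be group-sensitive.

`lean check`: rc 0; sorries = 2 = stubs (`stub_widthwiseGap`, `stub_crossoverWidth`), zero elsewhere.
Namespace `Summit.QuantumFields.YangMills.Cruxes.FibreContinuity.Birth`.
-/

set_option autoImplicit false

noncomputable section

namespace Summit.QuantumFields.YangMills.Cruxes.FibreContinuity.Birth

open MeasureTheory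
open Literature.MathematicalPhysics.QuantumFieldTheory
open Summit.QuantumFields.YangMills.Theses.ContractibleFibre

/-! ## The free-tube vocabulary, named (body VERBATIM the route's inline `let Tube := …`) -/

/-- **Time-clustering of the free tube of width `M`** at inverse coupling `β`, rate `m`, constant `C`,
slab width `w`, volume floor `Lmin` — verbatim the body of the `let Tube := fun M β m C w Lmin => …` of
`Theses/ContractibleFibre.lean` (sites `(ℤ/L)×(ℤ/L)×Fin(M+1)×Fin(M+1)`, links `(site, direction)`,
Wilson weight with the inside-the-tube indicator `ins` (free fibre boundary), product Haar,
ratio-of-integrals expectation `Ex`, time shift `σ`, time-slab locality `Loc`), with the measurable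
structure of `G` a parameter (the route instantiates it at `borel G`). -/
def TubeClusters (G : Type) [Group G] [TopologicalSpace G] [IsTopologicalGroup G] [CompactSpace G] [MeasurableSpace G] [BorelSpace G] (r : LatticeRep G) (M : ℕ) (β m C : ℝ) (w Lmin : ℕ) : Prop :=
  ∀ (L : ℕ) [NeZero L], Lmin ≤ L → let St := ZMod L × ZMod L × Fin (M + 1) × Fin (M + 1); let Cfg := St × Fin 4 → G; let ν : MeasureTheory.Measure Cfg := MeasureTheory.Measure.pi fun _ => Literature.MathematicalPhysics.QuantumFieldTheory.haarProbability G; let sh : St → Fin 4 → St := fun x μ => ![(x.1 + 1, x.2.1, x.2.2.1, x.2.2.2), (x.1, x.2.1 + 1, x.2.2.1, x.2.2.2), (x.1, x.2.1, x.2.2.1 + 1, x.2.2.2), (x.1, x.2.1, x.2.2.1, x.2.2.2 + 1)] μ; let ins : St → Fin 4 → Fin 4 → ℝ := fun x μ κ => if ((μ = 2 ∨ κ = 2) → (x.2.2.1 : ℕ) < M) ∧ ((μ = 3 ∨ κ = 3) → (x.2.2.2 : ℕ) < M) then 1 else 0; let pl : Cfg → St → Fin 4 → Fin 4 → G := fun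 U x μ κ => U (x, μ) * U (sh x μ, κ) * (U (sh x κ, μ))⁻¹ * (U (x, κ))⁻¹; let act : Cfg → ℝ := fun U => β * ∑ x : St, ∑ q : {q : Fin 4 × Fin 4 // q.1 < q.2}, ins x q.1.1 q.1.2 * (r.ρ (pl U x q.1.1 q.1.2)).trace.re; let wgt : Cfg → ℝ := fun U => Real.exp (act U); let Ex : (Cfg → ℝ) → ℝ := fun F => (∫ U, F U * wgt U ∂ν) / (∫ U, wgt U ∂ν); let σ : ℕ → Cfg → Cfg := fun n U p => U ((p.1.1 + n, p.1.2), p.2); ∀ c : ZMod L, let Loc := fun F : Cfg → ℝ => Measurable F ∧ (∀ U, |F U| ≤ 1) ∧ ∀ U U', (∀ p : St × Fin 4, (p.1.1 - c).val ≤ w → U p = U' p) → F U = F U'; ∀ F₁ F₂ : Cfg → ℝ, Loc F₁ → Loc F₂ → ∀ n : ℕ, 2 * n < L → |Ex (fun U => F₁ U * F₂ (σ n U)) - Ex F₁ * Ex (fun U => F₂ (σ n U))| ≤ C * Real.exp (-(m * n))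

/-- **The crux's hypothesis for `r`** — the fixed-width anchor (verbatim the antecedent of
`FibreContinuity`, i.e. the conclusion of `FibreAnchor`, over `TubeClusters`): for every width `M`
there are `β₀(M)` and a `β`-uniform rate `m₀(M) > 0` with clustering for all `β ≥ β₀(M)`. -/
def AnchorAt (G : Type) [Group G] [TopologicalSpace G] [IsTopologicalGroup G] [CompactSpace G] [MeasurableSpace G] [BorelSpace G] (r : LatticeRep G) : Prop :=
  ∀ M : ℕ, ∃ β₀ m₀ : ℝ, 0 < m₀ ∧ ∀ β : ℝ, β₀ ≤ β → ∀ w : ℕ, ∃ C : ℝ, ∃ Lmin : ℕ, TubeClusters G r M β m₀ C w Lmin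

/-- **W — a gap on every tube at a width-uniform threshold** (statement of `stub_widthwiseGap`'s
conclusion): ONE `β₁` such that for all `β ≥ β₁` and EVERY width `M` the free tube of width `M`
clusters in time at some rate `m(β, M) > 0` with some constants `C(β, M, w)` (no uniformity in `M`). -/
def WidthwiseGap (G : Type) [Group G] [TopologicalSpace G] [IsTopologicalGroup G] [CompactSpace G] [MeasurableSpace G] [BorelSpace G] (r : LatticeRep G) : Prop :=
  ∃ β₁ : ℝ, ∀ β : ℝ, β₁ ≤ β → ∀ M : ℕ, ∃ m : ℝ, 0 < m ∧ ∀ w : ℕ, ∃ C : ℝ, ∃ Lmin : ℕ, TubeClusters G r M β m C w Lmin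

/-- **X — one rate beyond a crossover width** (statement of `stub_crossoverWidth`'s conclusion): there
is `β₁` such that for all `β ≥ β₁` there are a crossover width `M₀(β)`, ONE rate `m(β) > 0` and per slab
width ONE constant `C(β, w)` clustering every free tube of width `M ≥ M₀(β)`. -/
def CrossoverWidth (G : Type) [Group G] [TopologicalSpace G] [IsTopologicalGroup G] [CompactSpace G] [MeasurableSpace G] [BorelSpace G] (r : LatticeRep G) : Prop :=
  ∃ β₁ : ℝ, ∀ β : ℝ, β₁ ≤ β → ∃ M₀ : ℕ, ∃ m : ℝ, 0 < m ∧ ∀ w : ℕ, ∃ C : ℝ, ∀ M : ℕ, M₀ ≤ M → ∃ Lmin : ℕ, TubeClusters G r M β m C w Lmin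

/-- **The crux's conclusion for `r`** (verbatim the consequent of `FibreContinuity` over
`TubeClusters`): ONE threshold, and for `β` beyond it ONE rate and width-uniform constants for the
free tubes of every width. -/
def UniformWidthGap (G : Type) [Group G] [TopologicalSpace G] [IsTopologicalGroup G] [CompactSpace G] [MeasurableSpace G] [BorelSpace G] (r : LatticeRep G) : Prop :=
  ∃ β₁ : ℝ, ∀ β : ℝ, β₁ ≤ β → ∃ m : ℝ, 0 < m ∧ ∀ w : ℕ, ∃ C : ℝ, ∀ M : ℕ, ∃ Lmin : ℕ, TubeClusters G r M β m C w Lmin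

/-! ## Registered stubs -/

/-- **Stub W — a gap on every free tube at a width-uniform coupling threshold (finite-width half;
XL/open).** For every compact simple `G` and faithful unitary `r`, at the Borel σ-algebra: IF the
fixed-width anchor holds (`AnchorAt`), THEN there is ONE `β₁`, independent of the width, such that for
every `β ≥ β₁` and every width `M` the free tube `(ℤ/L)²×{0..M}²` clusters in time at some rate
`m(β, M) > 0` with some constants (`WidthwiseGap`). Mechanism foreseen: for `β ≥ β₀(M)` it is the
anchor; for the remaining (wide) widths at that `β`, a gap of the width-`M` tube as a two-dimensional
system — transfer matrix in a long direction, compactness of the fibre, Kaluza–Klein masses of the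
neutral modes and 2-d confinement of the charged ones. Why it might fail: at `M ≳ ξ(β)` the tube is at
intermediate effective coupling where no expansion is known (cf. the open 2-d σ-model gap). -/
theorem stub_widthwiseGap :
    ∀ (G : Type) [Group G] [TopologicalSpace G] [IsTopologicalGroup G] [CompactSpace G], IsCompactSimpleLieGroup G → letI : MeasurableSpace G := borel G; haveI : BorelSpace G := ⟨rfl⟩; ∀ r : LatticeRep G, AnchorAt G r → WidthwiseGap G r := by
  sorry

/-- **Stub X — one rate beyond a crossover width (infrared core; open-problem, the hardest piece).**
For every compact simple `G` and faithful unitary `r`, at the Borel σ-algebra: IF the fixed-width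
anchor holds (`AnchorAt`), THEN there is `β₁` such that for every `β ≥ β₁` there are a crossover width
`M₀(β)`, ONE rate `m(β) > 0` and per slab width ONE constant clustering all free tubes of width
`M ≥ M₀(β)` (`CrossoverWidth`). This is where asymptotic freedom must be consumed (false for `U(1)`):
the 2-d adjoint-quiver gauge theory at flavour-'t Hooft coupling `2/β` keeps a gap bounded below
uniformly in the number `(M+1)²` of Kaluza–Klein flavours once `M` exceeds the crossover — dimensional
transmutation seen from two dimensions; the thin-width data (anchor, W) are available as input and
only widths beyond a `β`-dependent crossover are asked. Why it might fail: at `M ≍ ξ(β)` the quiver is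
strongly coupled and free 3-d faces might carry wall states below the bulk gap. -/
theorem stub_crossoverWidth :
    ∀ (G : Type) [Group G] [TopologicalSpace G] [IsTopologicalGroup G] [CompactSpace G], IsCompactSimpleLieGroup G → letI : MeasurableSpace G := borel G; haveI : BorelSpace G := ⟨rfl⟩; ∀ r : LatticeRep G, AnchorAt G r → CrossoverWidth G r := by
  sorry

/-! ## Name-keyed aliases of the stub statements (hypotheses of `FibreContinuity_of`)

The native skeleton audit (`#h21_check_skeleton`) admits a `Prop` hypothesis of the skeleton theorem
only if its head constant is a registered obligation or is NAMED like a declared stub;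
`__Registered.stub_X` is the statement of `stub_X` under that name (device of the registered birth
skeletons, e.g. `Cruxes/ContinuumFromLatticeGap/Lines/birth.lean`). Each alias is syntactically the
statement of its stub. -/
namespace __Registered

/-- Statement of `stub_widthwiseGap`, keyed by the stub name. -/
abbrev stub_widthwiseGap : Prop :=
  ∀ (G : Type) [Group G] [TopologicalSpace G] [IsTopologicalGroup G] [CompactSpace G], IsCompactSimpleLieGroup G → letI : MeasurableSpace G := borel G; haveI : BorelSpace G := ⟨rfl⟩; ∀ r : LatticeRep G, AnchorAt G r → WidthwiseGap G r

/-- Statement of `stub_crossoverWidth`, keyed by the stub name. -/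
abbrev stub_crossoverWidth : Prop :=
  ∀ (G : Type) [Group G] [TopologicalSpace G] [IsTopologicalGroup G] [CompactSpace G], IsCompactSimpleLieGroup G → letI : MeasurableSpace G := borel G; haveI : BorelSpace G := ⟨rfl⟩; ∀ r : LatticeRep G, AnchorAt G r → CrossoverWidth G r

end __Registered

/-! ## Glue (no `sorry` below this line) -/

/-- **Monotonicity of the clustering bound in (rate, constant)**: clustering at rate `m` with constant
`C` implies clustering at any rate `m' ≤ m` with any constant `C' ≥ |C|`
(`C e^(−mn) ≤ |C| e^(−mn) ≤ C' e^(−mn) ≤ C' e^(−m'n)` for `n ≥ 0`). The only place the body of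
`TubeClusters` is opened. -/
theorem TubeClusters.mono {G : Type} [Group G] [TopologicalSpace G] [IsTopologicalGroup G]
    [CompactSpace G] [MeasurableSpace G] [BorelSpace G] {r : LatticeRep G} {M : ℕ}
    {β m m' C C' : ℝ} {w Lmin : ℕ} (h : TubeClusters G r M β m C w Lmin) (hm : m' ≤ m)
    (hC : |C| ≤ C') : TubeClusters G r M β m' C' w Lmin := by
  intro L _ hL St Cfg ν sh ins pl act wgt Ex σ c Loc F₁ F₂ hF₁ hF₂ n hn
  have key := h L hL c F₁ F₂ hF₁ hF₂ n hn
  have hexp : Real.exp (-(m * n)) ≤ Real.exp (-(m' * n)) :=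
    Real.exp_le_exp.mpr (neg_le_neg (mul_le_mul_of_nonneg_right hm (Nat.cast_nonneg n)))
  have hbound : C * Real.exp (-(m * n)) ≤ C' * Real.exp (-(m' * n)) :=
    calc C * Real.exp (-(m * n)) ≤ |C| * Real.exp (-(m * n)) :=
          mul_le_mul_of_nonneg_right (le_abs_self C) (Real.exp_pos _).le
      _ ≤ C' * Real.exp (-(m * n)) := mul_le_mul_of_nonneg_right hC (Real.exp_pos _).le
      _ ≤ C' * Real.exp (-(m' * n)) := mul_le_mul_of_nonneg_left hexp ((abs_nonneg C).trans hC)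
  exact key.trans hbound

/-- **Finite ranges of widths** (pure bookkeeping over an abstract family `T M m C w Lmin`, monotone
in (rate, constant)): a gap at every width gives, on each finite range `M < M₀`, ONE rate and ONE
constant per `w` — minimum rate, maximum `|constant|`, by induction on `M₀`. -/
theorem range_uniform {T : ℕ → ℝ → ℝ → ℕ → ℕ → Prop}
    (hmono : ∀ (M : ℕ) (m m' C C' : ℝ) (w Lmin : ℕ), T M m C w Lmin → m' ≤ m → |C| ≤ C' → T M m' C' w Lmin)
    (h : ∀ M : ℕ, ∃ m : ℝ, 0 < m ∧ ∀ w : ℕ, ∃ C : ℝ, ∃ Lmin : ℕ, T M m C w Lmin) :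
    ∀ M₀ : ℕ, ∃ m : ℝ, 0 < m ∧ ∀ w : ℕ, ∃ C : ℝ, ∀ M : ℕ, M < M₀ → ∃ Lmin : ℕ, T M m C w Lmin := by
  intro M₀
  induction M₀ with
  | zero => exact ⟨1, one_pos, fun w => ⟨0, fun M hM => absurd hM (Nat.not_lt_zero M)⟩⟩
  | succ M₀ ih =>
    obtain ⟨m₁, hm₁, h₁⟩ := ih
    obtain ⟨m₂, hm₂, h₂⟩ := h M₀
    refine ⟨min m₁ m₂, lt_min hm₁ hm₂, fun w => ?_⟩
    obtain ⟨C₁, hC₁⟩ := h₁ w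
    obtain ⟨C₂, Lmin₂, hC₂⟩ := h₂ w
    refine ⟨max |C₁| |C₂|, fun M hM => ?_⟩
    rcases (Nat.lt_succ_iff.mp hM).lt_or_eq with hlt | rfl
    · obtain ⟨Lmin, hL⟩ := hC₁ M hlt
      exact ⟨Lmin, hmono _ _ _ _ _ _ _ hL (min_le_left _ _) (le_max_left _ _)⟩
    · exact ⟨Lmin₂, hmono _ _ _ _ _ _ _ hC₂ (min_le_right _ _) (le_max_right _ _)⟩

/-- **Joining a finite range with a uniform tail** (pure bookkeeping): one rate/constant below `M₀` and
one rate/constant from `M₀` on give one rate/constant for all widths. -/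
theorem all_widths {T : ℕ → ℝ → ℝ → ℕ → ℕ → Prop}
    (hmono : ∀ (M : ℕ) (m m' C C' : ℝ) (w Lmin : ℕ), T M m C w Lmin → m' ≤ m → |C| ≤ C' → T M m' C' w Lmin)
    {M₀ : ℕ} (hlow : ∃ m : ℝ, 0 < m ∧ ∀ w : ℕ, ∃ C : ℝ, ∀ M : ℕ, M < M₀ → ∃ Lmin : ℕ, T M m C w Lmin)
    (hhigh : ∃ m : ℝ, 0 < m ∧ ∀ w : ℕ, ∃ C : ℝ, ∀ M : ℕ, M₀ ≤ M → ∃ Lmin : ℕ, T M m C w Lmin) :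
    ∃ m : ℝ, 0 < m ∧ ∀ w : ℕ, ∃ C : ℝ, ∀ M : ℕ, ∃ Lmin : ℕ, T M m C w Lmin := by
  obtain ⟨m₁, hm₁, h₁⟩ := hlow
  obtain ⟨m₂, hm₂, h₂⟩ := hhigh
  refine ⟨min m₁ m₂, lt_min hm₁ hm₂, fun w => ?_⟩
  obtain ⟨C₁, hC₁⟩ := h₁ w
  obtain ⟨C₂, hC₂⟩ := h₂ w
  refine ⟨max |C₁| |C₂|, fun M => ?_⟩
  rcases Nat.lt_or_ge M M₀ with hlt | hle
  · obtain ⟨Lmin, hL⟩ := hC₁ M hlt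
    exact ⟨Lmin, hmono _ _ _ _ _ _ _ hL (min_le_left _ _) (le_max_left _ _)⟩
  · obtain ⟨Lmin, hL⟩ := hC₂ M hle
    exact ⟨Lmin, hmono _ _ _ _ _ _ _ hL (min_le_right _ _) (le_max_right _ _)⟩

/-- **W and X give the crux's conclusion, for one `r` at any measurable structure**: thresholds joined
by `max`, the crossover width from X, the finitely many thinner widths from W (`range_uniform`), the
two regimes joined by `all_widths`, monotonicity from `TubeClusters.mono`. -/
theorem uniformWidthGap_of (G : Type) [Group G] [TopologicalSpace G] [IsTopologicalGroup G] [CompactSpace G] [MeasurableSpace G] [BorelSpace G] (r : LatticeRep G)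
    (hW : WidthwiseGap G r) (hX : CrossoverWidth G r) : UniformWidthGap G r := by
  obtain ⟨β₁, h₁⟩ := hW
  obtain ⟨β₂, h₂⟩ := hX
  refine ⟨max β₁ β₂, fun β hβ => ?_⟩
  obtain ⟨M₀, hhigh⟩ := h₂ β ((le_max_right _ _).trans hβ)
  have hmono : ∀ (M : ℕ) (m m' C C' : ℝ) (w Lmin : ℕ), TubeClusters G r M β m C w Lmin → m' ≤ m →
      |C| ≤ C' → TubeClusters G r M β m' C' w Lmin :=
    fun M m m' C C' w Lmin h hm hC => h.mono hm hC
  exact all_widths (T := fun M m C w Lmin => TubeClusters G r M β m C w Lmin) hmono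
    (range_uniform (T := fun M m C w Lmin => TubeClusters G r M β m C w Lmin) hmono
      (h₁ β ((le_max_left _ _).trans hβ)) M₀) hhigh

/-! ## Composition: the crux BY NAME from the two stub statements (no `sorry`) -/

/-- **`FibreContinuity_of`** — the registered skeleton theorem: hypotheses = the two stub statements
under their registered names, conclusion = the route decl
`Summit.QuantumFields.YangMills.Theses.ContractibleFibre.FibreContinuity`, literally. The route's
`let Tube := …` is introduced as a local definition; the crux's antecedent is passed to W and X as
`AnchorAt G r` and their joint consequence `UniformWidthGap G r` (theorem `uniformWidthGap_of` at the
Borel σ-algebra `borel G`, `BorelSpace` witness `⟨rfl⟩` exactly as in the route file) is the crux's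
consequent — all by definitional unfolding of the verbatim-copied vocabulary, no restatement. -/
theorem FibreContinuity_of (hW : __Registered.stub_widthwiseGap)
    (hX : __Registered.stub_crossoverWidth) :
    Summit.QuantumFields.YangMills.Theses.ContractibleFibre.FibreContinuity := by
  intro G _ _ _ _ hG
  letI : MeasurableSpace G := borel G
  haveI : BorelSpace G := ⟨rfl⟩
  intro r Tube hA
  exact uniformWidthGap_of G r (hW G hG r hA) (hX G hG r hA)

/-- The stubs BY NAME compose to the crux (this `example` is the only place the two `sorry`s would
enter a proof of the crux; `FibreContinuity_of` itself is closed). -/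
example : Summit.QuantumFields.YangMills.Theses.ContractibleFibre.FibreContinuity :=
  FibreContinuity_of stub_widthwiseGap stub_crossoverWidth

/-- Sanity (definitions compute, in kind): the crux's hypothesis and conclusion ARE `AnchorAt` and
`UniformWidthGap` at the Borel σ-algebra — the unconditional reduction
`(∀ G r, AnchorAt → UniformWidthGap) → FibreContinuity` by definitional unfolding alone. -/
example (h : ∀ (G : Type) [Group G] [TopologicalSpace G] [IsTopologicalGroup G] [CompactSpace G], IsCompactSimpleLieGroup G → letI : MeasurableSpace G := borel G; haveI : BorelSpace G := ⟨rfl⟩; ∀ r : LatticeRep G, AnchorAt G r → UniformWidthGap G r) :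
    Summit.QuantumFields.YangMills.Theses.ContractibleFibre.FibreContinuity := by
  intro G _ _ _ _ hG r Tube hA
  exact h G hG r hA

end Summit.QuantumFields.YangMills.Cruxes.FibreContinuity.Birth

end
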